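import Literature.NumberTheory.Rogawski1990.U3PrincipalSeriesWeylConjugate
import HarnessLib

/-!
# K1w ★ `Rogawski1990.cmPrincipalSeries_isConstituentOf_weylConj` UNFOLDED as a theorem

The booked letter K1w (#98) [Rogawski1990, §12.2 p. 173–174: `JH(i_G(χ)) = JH(i_G(wχ))` for `U(Φ₃)(L⁺_v)`] is a `def … : Prop`; Lean abstracts
the ten proofs nested in its value into private aux constants `cmPrincipalSeries_isConstituentOf_weylConj._proof_1 … _proof_10` (eight
instances, the `hJ` proof ★ `cmLocalForm_eq_over L 3 v`, and ★ `locallyCompactSpace_cmBorelU L 3 v`).  At the ≈ 10⁷-node carrier type of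
`cmPrincipalSeries L 3 v χ` the elaborator's `isDefEq` between the def's body and a theorem-world elaboration of the same text is pathologically
slow (measured on the sister letter N1: > 600 s), so consumers and the in-house discharge (the K1 sub-line's pay-down, files
`Theorems/F0P2pWeylConstituentsRankOne`, `…F0P2pCmPrincipalSeriesInterface`) need a THEOREM-WORLD BRIDGE.  Device (B-p10 (g21), ★
`U3PrincipalSeriesJacquetFiltrationFullUnfold`): ten `rfl`-lemmas `aux_proof_k : _proof_k = ‹the term a theorem statement carries›` and
`dsimp only [aux_proof_1, …, aux_proof_10, inferInstance]` visiting proofs and instance arguments; then both sides agree syntactically.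
Result: `cmPrincipalSeries_isConstituentOf_weylConj_iff : cmPrincipalSeries_isConstituentOf_weylConj ↔ <body verbatim>`; the discharge is then
`(cmPrincipalSeries_isConstituentOf_weylConj_iff).2 ‹theorem-world proof›`.  Theorems only (10 private `rfl` lemmas + 1 theorem); no definition,
no named fact, no instance.

## References
[Rogawski1990] §12.2 pp. 173–174 · [Casselman1995] §7.1 (L. 7.1.1, Cor. 7.1.2) · [BernsteinZelevinsky1977] Thm. 2.9.
-/

set_option autoImplicit false

noncomputable section

open NumberField IsDedekindDomain MeasureTheory
open scoped Matrix

namespace Literature.NumberTheory.Rogawski1990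

open Literature.NumberTheory Literature.NumberTheory.Automorphic Literature.NumberTheory.Automorphic.UnitaryGroup

/-! ## §0 The ten aux constants of the `def` K1w, identified with the terms a theorem statement carries -/

set_option linter.auxLemma false in
/-- `_proof_1` is the instance `SubsemiringClass (Subfield L) L`. [cite: Rogawski1990, §12.2 p. 173] -/
private theorem aux_proof_1 (L : Type) [Field L] :
    Eq (@cmPrincipalSeries_isConstituentOf_weylConj._proof_1 L _) inferInstance := rfl

set_option linter.auxLemma false in
/-- `_proof_2` is the instance `Algebra.IsIntegral ℚ L`. [cite: Rogawski1990, §12.2 p. 173] -/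
private theorem aux_proof_2 (L : Type) [Field L] [NumberField L] :
    Eq (@cmPrincipalSeries_isConstituentOf_weylConj._proof_2 L _ _) inferInstance := rfl

set_option linter.auxLemma false in
/-- `_proof_3` is the instance `IsDomain (𝓞 L⁺)`. [cite: Rogawski1990, §12.2 p. 173] -/
private theorem aux_proof_3 (L : Type) [Field L] :
    Eq (@cmPrincipalSeries_isConstituentOf_weylConj._proof_3 L _) inferInstance := rfl

set_option linter.auxLemma false in
/-- `_proof_4` is the instance `Algebra.IsIntegral (𝓞 L⁺) (𝓞 L)`. [cite: Rogawski1990, §12.2 p. 173] -/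
private theorem aux_proof_4 (L : Type) [Field L] :
    Eq (@cmPrincipalSeries_isConstituentOf_weylConj._proof_4 L _) inferInstance := rfl

set_option linter.auxLemma false in
/-- `_proof_5` is the instance `NumberField L⁺`. [cite: Rogawski1990, §12.2 p. 173] -/
private theorem aux_proof_5 (L : Type) [Field L] [NumberField L] :
    Eq (@cmPrincipalSeries_isConstituentOf_weylConj._proof_5 L _ _) inferInstance := rfl

set_option linter.auxLemma false in
/-- `_proof_6` is the instance `SeparatelyContinuousMul (U(Φ₃)(L⁺_v))`. [cite: Rogawski1990, §12.2 p. 173] -/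
private theorem aux_proof_6 (L : Type) [Field L] [NumberField L] [IsCMField L]
    (v : HeightOneSpectrum (𝓞 ↥(maximalRealSubfield L))) :
    Eq (@cmPrincipalSeries_isConstituentOf_weylConj._proof_6 L _ _ _ v) inferInstance := rfl

set_option linter.auxLemma false in
/-- `_proof_7` is the proof ★ `cmLocalForm_eq_over L 3 v` (the `hJ` argument of `torusCharPair`). [cite: Rogawski1990, §12.2 p. 173] -/
private theorem aux_proof_7 (L : Type) [Field L] [NumberField L]
    (v : HeightOneSpectrum (𝓞 ↥(maximalRealSubfield L))) :
    Eq (@cmPrincipalSeries_isConstituentOf_weylConj._proof_7 L _ _ v) (cmLocalForm_eq_over L 3 v) := rfl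

set_option linter.auxLemma false in
/-- `_proof_8` is the instance `IsTopologicalGroup (U(Φ₃)(L⁺_v))`. [cite: Rogawski1990, §12.2 p. 173] -/
private theorem aux_proof_8 (L : Type) [Field L] [NumberField L] [IsCMField L]
    (v : HeightOneSpectrum (𝓞 ↥(maximalRealSubfield L))) :
    Eq (@cmPrincipalSeries_isConstituentOf_weylConj._proof_8 L _ _ _ v) inferInstance := rfl

set_option linter.auxLemma false in
/-- `_proof_9` is ★ `locallyCompactSpace_cmBorelU L 3 v` (carried by the type of ★ `cmPrincipalSeries`). [cite: Rogawski1990, §12.2 p. 173] -/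
private theorem aux_proof_9 (L : Type) [Field L] [NumberField L] [IsCMField L]
    (v : HeightOneSpectrum (𝓞 ↥(maximalRealSubfield L))) :
    Eq (@cmPrincipalSeries_isConstituentOf_weylConj._proof_9 L _ _ _ v) (locallyCompactSpace_cmBorelU L 3 v) := rfl

set_option linter.auxLemma false in
/-- `_proof_10` is the instance `MonoidHomClass (L_v →+* L_v) L_v L_v` (the coercion of `conjLocal` to a monoid hom). [cite: Rogawski1990, §12.2 p. 173] -/
private theorem aux_proof_10 (L : Type) [Field L] [NumberField L]
    (v : HeightOneSpectrum (𝓞 ↥(maximalRealSubfield L))) :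
    Eq (@cmPrincipalSeries_isConstituentOf_weylConj._proof_10 L _ _ v) inferInstance := rfl

/-! ## §1 The bridge -/

set_option backward.dsimp.proofs true in  -- `dsimp` must rewrite the `_proof_k` leaves, which are proofs in instance ∕ argument positions
set_option synthInstance.maxHeartbeats 400000 in  -- instance paths on the CM carrier (as in the sister bridges)
set_option maxHeartbeats 4000000 in  -- the statement + two `dsimp` passes over ≈ 10⁷-node terms
/-- **K1w unfolded** (★ `cmPrincipalSeries_isConstituentOf_weylConj`, verbatim body on the right): `JH(i_G(χ₁, χ₂)) = JH(i_G(χ̄₁⁻¹, χ₂))` for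
`U(Φ₃)(L⁺_v)` at every non-split `v`. [cite: Rogawski1990, §12.2 pp. 173–174] [cite: BernsteinZelevinsky1977, Thm. 2.9] -/
theorem cmPrincipalSeries_isConstituentOf_weylConj_iff :
    cmPrincipalSeries_isConstituentOf_weylConj ↔
    ∀ (L : Type) [Field L] [NumberField L] [IsCMField L] (v : HeightOneSpectrum (𝓞 ↥(maximalRealSubfield L))),
    (∀ w : PlacesOver L v, IsCMField.complexConj L • w.1 = w.1) →
    ∀ (χ₁ : (UnitaryGroup.LocalRing L v)ˣ →* ℂˣ) (χ₂ : ↥(normOneUnits (conjLocal L (IsCMField.complexConj L) v)) →* ℂˣ)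
      (c : IrrClass (Gqs L v)),
        c.IsConstituentOf (cmPrincipalSeries L 3 v
            (torusCharPair (conjLocal L (IsCMField.complexConj L) v) (cmLocalForm L 3 v) (cmLocalForm_eq_over L 3 v) 0 χ₁ χ₂)) ↔
          c.IsConstituentOf (cmPrincipalSeries L 3 v
            (torusCharPair (conjLocal L (IsCMField.complexConj L) v) (cmLocalForm L 3 v) (cmLocalForm_eq_over L 3 v) 0
              (χ₁.comp (Units.map (conjLocal L (IsCMField.complexConj L) v : UnitaryGroup.LocalRing L v →* UnitaryGroup.LocalRing L v)))⁻¹ χ₂)) := by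
  constructor
  · intro h L _ _ _ v hns χ₁ χ₂ c
    have key := h L v hns χ₁ χ₂ c
    dsimp (config := { failIfUnchanged := false, instances := true }) only [aux_proof_1, aux_proof_2, aux_proof_3, aux_proof_4, aux_proof_5, aux_proof_6, aux_proof_7, aux_proof_8, aux_proof_9, aux_proof_10, inferInstance] at key ⊢
    exact key
  · intro h L _ _ _ v hns χ₁ χ₂ c
    have key := h L v hns χ₁ χ₂ c
    dsimp (config := { failIfUnchanged := false, instances := true }) only [aux_proof_1, aux_proof_2, aux_proof_3, aux_proof_4, aux_proof_5, aux_proof_6, aux_proof_7, aux_proof_8, aux_proof_9, aux_proof_10, inferInstance] at key ⊢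
    exact key

end Literature.NumberTheory.Rogawski1990

end
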